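import Summits.QuantumAdvantage.QuantumAdvantage.Theses.ArithStatLadder
import Summits.QuantumAdvantage.QuantumAdvantage.Theorems.IqThreeMemBQP.Negative.RefutationCost
import Literature.Computability.Cryptography.HallgrenClassGroup
import HarnessLib.Audit

/-!
# Line `bright-sampler-meter` — crux `ArithStatLadder.IqThreeMemBQP` (stmt-QuantumAdvantage-2424) — skeleton v1

Planner `planner-cruxplan-stmt-QuantumAdvantage-2424-bright-sampler-meter-0` (crux-plan, round 1, 2026-08-16), from
the crux idea `Ideas/bright-sampler-meter.md` (TRIAGE-r1-1/2/3: pass ×3, "as a component: the trunk, not the whole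
tree"; bright-branch engines bright-sampler-meter ≈ torsion-witness-sampling).  Line card: `Lines/bright-sampler-meter.md`.

THE CRUX. `IqThreeMemBQP`: `IQ3 = bin {d : −d fundamental, 3 ∣ h(−d)} ∈ BQP` (tree's strict class), unconditionally.
Reading pinned by `Theorems.IqThreeMemBQP.Negative.iqThreeMemBQP_iff` (`Iff.rfl`; `IsNegFundamentalDiscr` is verbatim
the route's inline disjunction) — imported and used below.

THE LINE (meter-guarded brightness dichotomy).  Call `d` BRIGHT at level `A` when `√d ≤ 2·h(−d)·(log d)^A`
(⇔ `L(1,χ_{−d}) ≥ (π/2)(log d)^{−A}` by the class number formula, `d > 4`) and DARK at level `A` when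
`h(−d)·(log d)^A ≤ √d`.  Every `d` is bright or dark (slack factor `2`; `mem_brightSet_or_mem_darkSet`, proved), the
two regimes overlap in a factor-2 window, and WHICH regime holds is itself decidable as a promise problem by a
classical Monte-Carlo estimate of `L(1,χ_{−d})` to additive accuracy `(log d)^{−A}` (the card's log-uniform METER:
`poly(log d)` Kronecker symbols, tail `≤ 2d/X` from the PROVED `RealChar.abs_sum_Ioc_reChar_le`).  On BRIGHT inputs the
random-forms SAMPLER (uniform first coefficient `a ≤ √(d/3)`, a root `b` of `−d mod 4a`) escapes every proper subgroup of
`Cl(−d)` with probability `≥ 1/poly_A(log d)` — GRH-free: the tree's in-progress proof of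
`Hallgren2005_classNumber_qsolvable_of_GRH` (files `HallgrenClassGroup*.lean`, steps N1–N5, Q1–Q3, S5) uses GRH at ONE
place, N3d `sqrt_le_classNumber_mul_log_of_grandRiemannHypothesisGL : √d ≤ C·h(−d)·log d`, and the brightness PROMISE is
exactly that inequality read off the input (Cauchy–Schwarz over the tree's N4 lemmas even gives the card's quadratic law
`P[escape] ≥ h²/(4A²(1+log A)³)` with no threshold tuning).  So `h(−d)`, hence the bit `3 ∣ h`, is quantum-polynomial on
bright inputs with NO zero-free region and NO named fact.  DARK inputs (`L(1,χ_{−d}) ≤ π(log d)^{−A}`: the Landau–Siegel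
regime, where every factoring/sampling engine starves — Disproof §3) are HANDED to the Scholz-mirror line
(cards scholz-mirror-siegel ≈ mirror-dodge ≈ scholz-mirror-landau-page): there `χ_{−d}` has a real zero in Landau's
window (`Siegel.caseA` contrapositive), so the mirror field `ℚ(√3d)` is bright (`exists_landau_prodChar_min_le` + `caseA`,
all PROVED), and `3 ∣ h(−d) ⟺ 3 ∣ h(ℚ(√3d)) ∨ ε 3-primary` (refined Scholz reflection; unit side by the PROVED
`Hallgren2007_regulator_qsolvable_holds` ∘ `JacobsonWilliams2008_unitResidue_mem_FP_holds`).  A generic DISPATCH lemma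
(closure of `PromiseBQP`/`BQP` under meter-guarded two-way case distinction) and the VALIDITY test (fundamental
discriminants form a `BQP` language: Shor factoring + classical squarefree/congruence check) assemble the crux.

REGISTERED STUBS (sorry ONLY here; statements fully unfolded over tree declarations):
* `stub_validity`        [S1, size M, provable now]  `bin {d : IsNegFundamentalDiscr d} ∈ BQP`.
* `stub_brightBranch`    [S2, size XL, LOAD-BEARING for this line; architecture in tree]  `∀ A`, IQ3 restricted to
  bright-at-level-`A` fundamental discriminants `∈ PromiseBQP` (intended proof: the bright-promise CLASS NUMBER in
  `IsQSolvable`, i.e. `Hallgren2005_classNumber_qsolvable_of_GRH` with `GrandRiemannHypothesisGL` replaced by the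
  per-input promise, then decision-from-search).
* `stub_brightnessMeter` [S3, size M–L]  `∀ A`, the gap problem (yes: fundamental and NOT dark; no: fundamental and NOT
  bright) `∈ PromiseBQP` (indeed in textbook promise-`BPP`, `PromiseBPP'`).
* `stub_darkBranch`      [S4, size XL, HANDOFF = the merged mirror line restricted to dark inputs; the formally hardest]
  `∃ A`, IQ3 restricted to dark-at-level-`A` fundamental discriminants `∈ PromiseBQP`.
* `stub_guardedDispatch` [S5, size M, generic]  for sets `F S B D ⊆ ℕ` with `F ⊆ B ∪ D`: `bin F ∈ BQP`, the two
  regime-restricted problems and the meter in `PromiseBQP` ⟹ `bin (F ∩ S) ∈ BQP`.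
COMPOSITION `IqThreeMemBQP_of` (kernel-checked, concludes the crux BY NAME; hypotheses are the name-keyed aliases
`Registered.stub_*`): take `A` from S4, instantiate S2/S3 at `A`, cover lemma, S5, then `iqThreeMemBQP_iff`.

HONEST LABEL.  Alone, S1+S2+S3+S5 prove the PROMISE form "IQ3 is decided correctly on every bright input and the dark
inputs are RECOGNISED" (the card's stated standalone output); the crux closes jointly with S4, which is exactly what the
mirror line delivers on dark inputs (and which is trivially true under GRH, where dark sets are finite).  S2 and S4 are
each strictly WEAKER than the crux (regime restrictions), S5 is generic, S1/S3 are auxiliary decision problems: no stub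
restates the crux, the summit, or a refuted statement.

Disproof.lean used (refuter-cdisprove-stmt-QuantumAdvantage-2424-0, cycles 1/1b; landed `Negative.RefutationCost`,
IMPORTED here): no `_false_without_<H>` theorem exists — the crux is an atomic membership claim (§3), so there is no
hypothesis to honour; §3's load-bearing-for-TRUTH input ("poly(log d) generators of Cl(−d)") is MET on bright inputs by
sampled generators (S2) and REMOVED on dark inputs (S4, mirror); §4's refuted strengthening ("prime forms of norm
≤ log₂ d generate") is instantiated by NO stub — S2's sampler draws first coefficients up to `√(d/3)`; §4bis witness
`d = 547` (`h = 3`) is BRIGHT at every level `A ≤ 2` (`2·3·(log 547)² ≈ 238 ≥ √547 ≈ 23.4`) and is decided by S2 at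
norms `≤ 13`, never by small primes; §0/§1 model facts (`[] ∉ IQ3`, non-canonical words rejected, wire-0 read-out,
`IQ3 ≠ ∅, univ`) are obligations inside S1/S5 and are consistent with them.  `ledger negatives --problem
QuantumAdvantage` (5 items: SpinorFlattening, CubicForrelation, KummerSector, SeparableFrames, ShorLocallyDark) —
unrelated to class groups; no stub is an instance.
-/

noncomputable section

set_option linter.dupNamespace false

namespace Summit.QuantumAdvantage.QuantumAdvantage.Cruxes.IqThreeMemBQP.BrightSamplerMeter

open _root_.Computability Literature.Computability.Complexity Literature.Computability.Cryptography
open Literature.NumberTheory.QuadraticFields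
open Summit.QuantumAdvantage.QuantumAdvantage.Theses.ArithStatLadder (IqThreeMemBQP)

/-! ## Vocabulary (readable aliases; the registered stubs below are fully unfolded) -/

/-- `h(−d)`: the number of reduced primitive positive definite forms of discriminant `−d`
(= `|Cl(𝓞_K)|`, `K = ℚ(√−d)`, for `−d` fundamental: `IsNegFundamentalDiscr.classNumber_eq_card_classGroup`). -/
abbrev classNo (d : ℕ) : ℕ := BinaryQuadraticForm.classNumber (-(d : ℤ))

/-- Negative fundamental discriminants `−d` (verbatim the crux's inline disjunction). -/
def fundSet : Set ℕ := {d | IsNegFundamentalDiscr d}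

/-- `3 ∣ h(−d)`. -/
def threeSet : Set ℕ := {d | 3 ∣ classNo d}

/-- BRIGHT at level `A` (with slack factor `2`): `√d ≤ 2·h(−d)·(log d)^A`, i.e. (for `d > 4`, class number
formula `L(1,χ_{−d}) = π h/√d`) `L(1,χ_{−d}) ≥ (π/2)(log d)^{−A}`. -/
def brightSet (A : ℕ) : Set ℕ := {d | Real.sqrt (d : ℝ) ≤ 2 * (classNo d : ℝ) * Real.log (d : ℝ) ^ A}

/-- DARK at level `A`: `h(−d)·(log d)^A ≤ √d`, i.e. `L(1,χ_{−d}) ≤ π (log d)^{−A}` (Landau–Siegel regime). -/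
def darkSet (A : ℕ) : Set ℕ := {d | (classNo d : ℝ) * Real.log (d : ℝ) ^ A ≤ Real.sqrt (d : ℝ)}

/-! ## The five statements of the line (named; each IS its registered stub, see `*_holds`) -/

/-- S1 `ValidityInBQP`: the set of negative fundamental discriminants is a `BQP` language (Shor factoring
`factoring_mem_FBQP_holds` + classical squarefree/congruence test + `mem_BQP_of_isQSolvable_bit`; non-code-words and
`[]` rejected, cf. `Negative.nil_not_mem`). -/
def ValidityInBQP : Prop :=
  encodingNatBool.toLanguage {d : ℕ | IsNegFundamentalDiscr d} ∈ BQP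

/-- S2 `BrightBranch`: IQ3 restricted to BRIGHT fundamental discriminants is in `PromiseBQP`, at every level `A`
(GRH-free class-group generation by sampled reduced forms + the tree's Hallgren2005 architecture; decision from search). -/
def BrightBranch : Prop :=
  ∀ A : ℕ,
    (⟨encodingNatBool.toLanguage {d : ℕ | IsNegFundamentalDiscr d ∧
          Real.sqrt (d : ℝ) ≤ 2 * (BinaryQuadraticForm.classNumber (-(d : ℤ)) : ℝ) * Real.log (d : ℝ) ^ A ∧
          3 ∣ BinaryQuadraticForm.classNumber (-(d : ℤ))},
      encodingNatBool.toLanguage {d : ℕ | IsNegFundamentalDiscr d ∧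
          Real.sqrt (d : ℝ) ≤ 2 * (BinaryQuadraticForm.classNumber (-(d : ℤ)) : ℝ) * Real.log (d : ℝ) ^ A ∧
          ¬ 3 ∣ BinaryQuadraticForm.classNumber (-(d : ℤ))}⟩ : PromiseProblem) ∈ PromiseBQP

/-- S3 `BrightnessMeter`: the brightness gap problem — yes: fundamental and NOT dark (`h(log d)^A > √d`), no:
fundamental and NOT bright (`2h(log d)^A < √d`) — is in `PromiseBQP` (indeed classical `PromiseBPP'`), at every level
`A` (log-uniform Monte-Carlo estimate of `L(1,χ_{−d}) = π h/√d` to accuracy `(π/8)(log d)^{−A}`). -/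
def BrightnessMeter : Prop :=
  ∀ A : ℕ,
    (⟨encodingNatBool.toLanguage {d : ℕ | IsNegFundamentalDiscr d ∧
          ¬ ((BinaryQuadraticForm.classNumber (-(d : ℤ)) : ℝ) * Real.log (d : ℝ) ^ A ≤ Real.sqrt (d : ℝ))},
      encodingNatBool.toLanguage {d : ℕ | IsNegFundamentalDiscr d ∧
          ¬ (Real.sqrt (d : ℝ) ≤ 2 * (BinaryQuadraticForm.classNumber (-(d : ℤ)) : ℝ) * Real.log (d : ℝ) ^ A)}⟩ :
        PromiseProblem) ∈ PromiseBQP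

/-- S4 `DarkBranch`: IQ3 restricted to DARK fundamental discriminants is in `PromiseBQP`, at SOME level `A`
(handoff to the Scholz-mirror line: Landau repulsion makes `ℚ(√3d)` bright; refined Scholz reflection; unit primarity
by Hallgren–Pell + Jacobson–Williams; `3 ∣ h` of the bright real field by ideal sampling + one-class order finding). -/
def DarkBranch : Prop :=
  ∃ A : ℕ,
    (⟨encodingNatBool.toLanguage {d : ℕ | IsNegFundamentalDiscr d ∧
          ((BinaryQuadraticForm.classNumber (-(d : ℤ)) : ℝ) * Real.log (d : ℝ) ^ A ≤ Real.sqrt (d : ℝ)) ∧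
          3 ∣ BinaryQuadraticForm.classNumber (-(d : ℤ))},
      encodingNatBool.toLanguage {d : ℕ | IsNegFundamentalDiscr d ∧
          ((BinaryQuadraticForm.classNumber (-(d : ℤ)) : ℝ) * Real.log (d : ℝ) ^ A ≤ Real.sqrt (d : ℝ)) ∧
          ¬ 3 ∣ BinaryQuadraticForm.classNumber (-(d : ℤ))}⟩ : PromiseProblem) ∈ PromiseBQP

/-- S5 `GuardedDispatch`: `BQP` is closed under meter-guarded two-way dispatch of number problems.  For
`F ⊆ B ∪ D`: if validity `bin F ∈ BQP`, the `B`-restricted and `D`-restricted versions of "`d ∈ S`?" are in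
`PromiseBQP`, and the meter (yes: `F ∖ D`, no: `F ∖ B`) is in `PromiseBQP`, then `bin (F ∩ S) ∈ BQP` (amplify the four
families to error `1/24`, run them on copies of the input, classical MUX into wire `0`; on the overlap `B ∩ D` both
branches are correct, so the meter's answer there is immaterial). -/
def GuardedDispatch : Prop :=
  ∀ (F S B D : Set ℕ), F ⊆ B ∪ D →
    encodingNatBool.toLanguage F ∈ BQP →
    (⟨encodingNatBool.toLanguage {d : ℕ | d ∈ F ∧ d ∈ B ∧ d ∈ S},
      encodingNatBool.toLanguage {d : ℕ | d ∈ F ∧ d ∈ B ∧ d ∉ S}⟩ : PromiseProblem) ∈ PromiseBQP →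
    (⟨encodingNatBool.toLanguage {d : ℕ | d ∈ F ∧ d ∈ D ∧ d ∈ S},
      encodingNatBool.toLanguage {d : ℕ | d ∈ F ∧ d ∈ D ∧ d ∉ S}⟩ : PromiseProblem) ∈ PromiseBQP →
    (⟨encodingNatBool.toLanguage {d : ℕ | d ∈ F ∧ d ∉ D},
      encodingNatBool.toLanguage {d : ℕ | d ∈ F ∧ d ∉ B}⟩ : PromiseProblem) ∈ PromiseBQP →
    encodingNatBool.toLanguage {d : ℕ | d ∈ F ∧ d ∈ S} ∈ BQP

/-! ## Registered stubs — `sorry` lives ONLY in these five theorems (statements fully unfolded) -/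

/-- Stub S1 (= `ValidityInBQP`): fundamental discriminants form a `BQP` language.  Size M; provable now. -/
theorem stub_validity :
    encodingNatBool.toLanguage {d : ℕ | IsNegFundamentalDiscr d} ∈ BQP := by
  sorry

/-- Stub S2 (= `BrightBranch`): IQ3 on bright inputs ∈ `PromiseBQP`, every level `A`.  Size XL; LOAD-BEARING. -/
theorem stub_brightBranch : ∀ A : ℕ,
    (⟨encodingNatBool.toLanguage {d : ℕ | IsNegFundamentalDiscr d ∧
          Real.sqrt (d : ℝ) ≤ 2 * (BinaryQuadraticForm.classNumber (-(d : ℤ)) : ℝ) * Real.log (d : ℝ) ^ A ∧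
          3 ∣ BinaryQuadraticForm.classNumber (-(d : ℤ))},
      encodingNatBool.toLanguage {d : ℕ | IsNegFundamentalDiscr d ∧
          Real.sqrt (d : ℝ) ≤ 2 * (BinaryQuadraticForm.classNumber (-(d : ℤ)) : ℝ) * Real.log (d : ℝ) ^ A ∧
          ¬ 3 ∣ BinaryQuadraticForm.classNumber (-(d : ℤ))}⟩ : PromiseProblem) ∈ PromiseBQP := by
  sorry

/-- Stub S3 (= `BrightnessMeter`): the brightness gap problem ∈ `PromiseBQP`, every level `A`.  Size M–L. -/
theorem stub_brightnessMeter : ∀ A : ℕ,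
    (⟨encodingNatBool.toLanguage {d : ℕ | IsNegFundamentalDiscr d ∧
          ¬ ((BinaryQuadraticForm.classNumber (-(d : ℤ)) : ℝ) * Real.log (d : ℝ) ^ A ≤ Real.sqrt (d : ℝ))},
      encodingNatBool.toLanguage {d : ℕ | IsNegFundamentalDiscr d ∧
          ¬ (Real.sqrt (d : ℝ) ≤ 2 * (BinaryQuadraticForm.classNumber (-(d : ℤ)) : ℝ) * Real.log (d : ℝ) ^ A)}⟩ :
        PromiseProblem) ∈ PromiseBQP := by
  sorry

/-- Stub S4 (= `DarkBranch`): IQ3 on dark inputs ∈ `PromiseBQP`, some level `A`.  Size XL; HANDOFF (mirror line). -/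
theorem stub_darkBranch : ∃ A : ℕ,
    (⟨encodingNatBool.toLanguage {d : ℕ | IsNegFundamentalDiscr d ∧
          ((BinaryQuadraticForm.classNumber (-(d : ℤ)) : ℝ) * Real.log (d : ℝ) ^ A ≤ Real.sqrt (d : ℝ)) ∧
          3 ∣ BinaryQuadraticForm.classNumber (-(d : ℤ))},
      encodingNatBool.toLanguage {d : ℕ | IsNegFundamentalDiscr d ∧
          ((BinaryQuadraticForm.classNumber (-(d : ℤ)) : ℝ) * Real.log (d : ℝ) ^ A ≤ Real.sqrt (d : ℝ)) ∧
          ¬ 3 ∣ BinaryQuadraticForm.classNumber (-(d : ℤ))}⟩ : PromiseProblem) ∈ PromiseBQP := by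
  sorry

/-- Stub S5 (= `GuardedDispatch`): meter-guarded two-way dispatch inside `BQP`.  Size M; generic; provable now. -/
theorem stub_guardedDispatch : ∀ (F S B D : Set ℕ), F ⊆ B ∪ D →
    encodingNatBool.toLanguage F ∈ BQP →
    (⟨encodingNatBool.toLanguage {d : ℕ | d ∈ F ∧ d ∈ B ∧ d ∈ S},
      encodingNatBool.toLanguage {d : ℕ | d ∈ F ∧ d ∈ B ∧ d ∉ S}⟩ : PromiseProblem) ∈ PromiseBQP →
    (⟨encodingNatBool.toLanguage {d : ℕ | d ∈ F ∧ d ∈ D ∧ d ∈ S},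
      encodingNatBool.toLanguage {d : ℕ | d ∈ F ∧ d ∈ D ∧ d ∉ S}⟩ : PromiseProblem) ∈ PromiseBQP →
    (⟨encodingNatBool.toLanguage {d : ℕ | d ∈ F ∧ d ∉ D},
      encodingNatBool.toLanguage {d : ℕ | d ∈ F ∧ d ∉ B}⟩ : PromiseProblem) ∈ PromiseBQP →
    encodingNatBool.toLanguage {d : ℕ | d ∈ F ∧ d ∈ S} ∈ BQP := by
  sorry

/-! ### Consistency: each named statement IS its registered stub (definitional unfolding only) -/

theorem validityInBQP_holds : ValidityInBQP := stub_validity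
theorem brightBranch_holds : BrightBranch := stub_brightBranch
theorem brightnessMeter_holds : BrightnessMeter := stub_brightnessMeter
theorem darkBranch_holds : DarkBranch := stub_darkBranch
theorem guardedDispatch_holds : GuardedDispatch := stub_guardedDispatch

/-! ### Name-keyed aliases of the five statements (hypotheses of the composition)

`Registered.stub_x` abbreviates the statement of the registered stub `stub_x`, so that the skeleton audit
(`#h21_check_skeleton`, by-name policy on hypothesis heads) reads the hypotheses of `IqThreeMemBQP_of` as exactly the
five declared stubs. -/
namespace Registered

/-- Statement of stub S1 `stub_validity`. -/
abbrev stub_validity : Prop := ValidityInBQP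
/-- Statement of stub S2 `stub_brightBranch`. -/
abbrev stub_brightBranch : Prop := BrightBranch
/-- Statement of stub S3 `stub_brightnessMeter`. -/
abbrev stub_brightnessMeter : Prop := BrightnessMeter
/-- Statement of stub S4 `stub_darkBranch`. -/
abbrev stub_darkBranch : Prop := DarkBranch
/-- Statement of stub S5 `stub_guardedDispatch`. -/
abbrev stub_guardedDispatch : Prop := GuardedDispatch

end Registered

/-! ## Proved glue (no `sorry` below this line) -/

/-- The two regimes COVER every natural number (not only fundamental discriminants): if `d` is not
bright at level `A` then `2h(log d)^A < √d`, so a fortiori `h(log d)^A ≤ √d` (`h ≥ 0` and `log d ≥ 0` for `d : ℕ`).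
This is why the bright threshold carries the slack factor `2`: the overlap `B ∩ D` is the meter's don't-care window. -/
theorem mem_brightSet_or_mem_darkSet (A d : ℕ) : d ∈ brightSet A ∨ d ∈ darkSet A := by
  by_cases hb : Real.sqrt (d : ℝ) ≤ 2 * (classNo d : ℝ) * Real.log (d : ℝ) ^ A
  · exact Or.inl hb
  · right
    have h0 : (0 : ℝ) ≤ (classNo d : ℝ) * Real.log (d : ℝ) ^ A :=
      mul_nonneg (Nat.cast_nonneg _) (pow_nonneg (Real.log_natCast_nonneg d) A)
    have hb' : 2 * (classNo d : ℝ) * Real.log (d : ℝ) ^ A < Real.sqrt (d : ℝ) := lt_of_not_ge hb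
    show (classNo d : ℝ) * Real.log (d : ℝ) ^ A ≤ Real.sqrt (d : ℝ)
    linarith

/-- Cover in subset form, for `GuardedDispatch`. -/
theorem fundSet_subset (A : ℕ) : fundSet ⊆ brightSet A ∪ darkSet A :=
  fun d _ => mem_brightSet_or_mem_darkSet A d

/-- **Assembly (pure logic).** The five statements give `IQ3 ∈ BQP` in the reading
`toLanguage {d | IsNegFundamentalDiscr d ∧ 3 ∣ h(−d)} ∈ BQP` (`Negative.iqThreeMemBQP_iff`): take the dark level `A`
from S4, run S2/S3 at the same `A`, dispatch with S5 over the cover lemma (all set-builder memberships unfold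
definitionally). -/
theorem iqThree_mem_BQP (hV : ValidityInBQP) (hB : BrightBranch) (hM : BrightnessMeter) (hK : DarkBranch)
    (hG : GuardedDispatch) :
    encodingNatBool.toLanguage
      {d : ℕ | IsNegFundamentalDiscr d ∧ 3 ∣ BinaryQuadraticForm.classNumber (-(d : ℤ))} ∈ BQP := by
  obtain ⟨A, hKA⟩ := hK
  exact hG fundSet threeSet (brightSet A) (darkSet A) (fundSet_subset A) hV (hB A) hKA (hM A)

/-! ## The composition (kernel-checked; concludes the crux BY NAME) -/

/-- **`IqThreeMemBQP_of`** — the glue of the line: validity test (S1), brightness meter (S3), bright branch (S2: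
GRH-free class-group generation on bright inputs), dark branch (S4: handed to the Scholz-mirror line), dispatched (S5);
the crux follows by its definitional reading `iqThreeMemBQP_iff`. -/
theorem IqThreeMemBQP_of (hV : Registered.stub_validity) (hB : Registered.stub_brightBranch)
    (hM : Registered.stub_brightnessMeter) (hK : Registered.stub_darkBranch)
    (hG : Registered.stub_guardedDispatch) : IqThreeMemBQP :=
  Theorems.IqThreeMemBQP.Negative.iqThreeMemBQP_iff.mpr (iqThree_mem_BQP hV hB hM hK hG)

/-- Wiring check: the registered stubs feed `IqThreeMemBQP_of` as stated (definitional unfolding only). -/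
example : IqThreeMemBQP :=
  IqThreeMemBQP_of stub_validity stub_brightBranch stub_brightnessMeter stub_darkBranch stub_guardedDispatch

end Summit.QuantumAdvantage.QuantumAdvantage.Cruxes.IqThreeMemBQP.BrightSamplerMeter

end
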